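import Summits.BirchSwinnertonDyer.BirchSwinnertonDyer.Theorems.PrintCf2SplitBadTwoObstructionWstar
import Summits.BirchSwinnertonDyer.Rank1Residual.X11b.LevelLiftingWithP
import HarnessLib

/-!
# Crux `PrintCf2.SplitBadTwoRankOneOfFacts` (stmt-BirchSwinnertonDyer-20368), road α v10.3, S3c residual (R-TOP) = brick B17, towards (LS):
# (P9⁺) FOR `E[𝔮^∞]`-FAMILIES — X11b's `levelLiftingP_of_finite` WITHOUT «`E[p^∞]^{Γ_K} = 0`» AND WITHOUT «`E[p^∞]^{Γ_{K_𝔭}} = 0`»: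
# prescribed `E[𝔮^∞]`-valued local classes on `Σ ∪ {𝔭}` are realised by a global class of Castella's propagated Selmer group

Cell `bsd-print-cf2`, EXTRA WIDTH seat `bsd-line-cf2-p1-w4` g9 (prover-bsd-line-cf2-p1-w4-g9-0); `--supports stmt-BirchSwinnertonDyer-20368`
(helper, Theses-free). HONEST FRAMING: nothing here closes the crux or a registered stub; BSD is not proved by any of this; no summit statement
is proved by this seat. No definition, no named fact, no `sorry`. CONDITIONAL on the cited fact `poitouTate_selmerStructure_duality K` (hypothesis
`hPT`, exactly as in X11b).

WHAT (TURNKEY-20368-LS-w4g9.md §2(d)). **`levelLiftingP_of_proj`**: given the CM splitting `E[p^∞] = E[𝔮^∞] ⊕ E[𝔮̄^∞]` by equivariant projectors `e`, `e′`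
(-w7 g2) with the associated endomorphisms `j = ι e`, `j′ = ι′ e′` of `E[p^∞]`, the FINITENESS OF THE `E[𝔮̄^∞]`-PART `H¹(j′)(H¹_{𝓛^{ac,R}_𝔮}(K, E[p^∞]))`
of Castella's relaxed conjugate group (hfinB′-currency, `hfin'`), a bound on the local torsion `E[p^∞]^{Γ_{K_𝔮}}` (`hfix`), and the cyclicity of
the summand at every level (`hcyc`): every family `τ_v ∈ H¹(K_v, E[p^∞])`, `v ∈ Σ ∪ {𝔭}`, of `E[𝔮^∞]`-CLASSES (`H¹(j) τ_v = τ_v`) killed by `p^{K₀}` is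
`loc_v (H¹(ι_N) x)` for some `N` and some `x ∈ H¹_{𝓖⁺}(K, E[p^N])` (`𝓖⁺ = upperStructureP`). Proof = X11b's `levelLiftingP_of_finite` with `K₁ = K₀ + m`,
level projectors `ẽ_{K₁}`, `ẽ_N`, `ẽ′_N` (p669287 `exists_levelProj`), local lifts `s_v := H¹(ẽ_{K₁}) s_v`, the obstruction killed by p670877
`sum_localTatePairingZMod_liftFamily_eq_zero_of_proj`, and at `𝔭` the lower structure equal to the KERNEL of `H¹(ι_N)|_{K_𝔭}` (`acLevelStructure_eq_ker_of`,
`acStructure_self`) — invisible after `H¹(ι_N)` — instead of `0`.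
presearch: JSW17 Prop. 3.3.2 / Lemma 3.3.3; Castella 2018 Thm. 2.3; no new fact. beyond-print theorem: no.

References: [JetchevSkinnerWan2017] Prop. 3.3.2, Lemma 3.3.3; [Howard2004HeegnerKolyvagin] Thm. 2.1.11; [Castella2018] Def. 2.2, Thm. 2.3.
-/

noncomputable section

open scoped Classical

set_option linter.dupNamespace false
set_option autoImplicit false

open CategoryTheory Field NumberField IsDedekindDomain
open Literature.NumberTheory.EllipticCurves Literature.NumberTheory.EllipticCurves.GreenbergSelmer
open Literature.NumberTheory.GaloisRepresentations
open Literature.NumberTheory.GaloisRepresentations.DiscreteGaloisModule (SelmerStructure TateDual tateDual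
  localTatePairingZMod unramifiedSubgroup)
open Literature.NumberTheory.GaloisCohomology
open scoped ContRepresentation
open Summit.BirchSwinnertonDyer.Rank1Residual.X11b
open Summit.BirchSwinnertonDyer.Rank1Residual.X11b.LocBridge
open Summit.BirchSwinnertonDyer.Rank1Residual.X11b.Levels
open Summit.BirchSwinnertonDyer.Rank1Residual.X11b.AcSelmer

namespace Summit.BirchSwinnertonDyer.BirchSwinnertonDyer.Theorems.PrintCf2.LevelEigen

/-! ## §1. An equivariant additive endomorphism of `E[p^∞]` as a continuous intertwining map -/

section Endo

variable {F : Type} [Field F] (V : WeierstrassCurve F) (p : ℕ)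

/-- An additive `Γ_F`-equivariant endomorphism of `E[p^∞]` IS a continuous intertwining endomorphism of the discrete Galois module `E[p^∞]`
(existence form, no definition; e.g. `ι ∘ e` for an eigen-projector `e`). [cite: SerreGaloisCohomology1997, I §2.4] -/
theorem exists_primaryEndo (f : V.geomPrimaryTorsion p →+ V.geomPrimaryTorsion p)
    (hf : ∀ (σ : absoluteGaloisGroup F) (x : V.geomPrimaryTorsion p), f (σ • x) = σ • f x) :
    ∃ j : (primaryGaloisModule V p).toContRepresentation →ⁱL (primaryGaloisModule V p).toContRepresentation, ∀ x, j x = f x :=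
  ⟨⟨⟨f.toIntLinearMap, continuous_of_discreteTopology⟩, fun σ ↦ by ext x; exact congrArg Subtype.val (hf σ x)⟩, fun _ ↦ rfl⟩

end Endo

/-! ## §2. (P9⁺) for `E[𝔮^∞]`-families -/

section Lift

variable {K : Type} [Field K] [NumberField K] (W : WeierstrassCurve K) [W.IsElliptic] (p : ℕ)
  [Fact p.Prime] (π : W.endRing) (r r' : ℤ_[p]) (𝔭 : HeightOneSpectrum (𝓞 K)) (S : Set (HeightOneSpectrum (𝓞 K)))

/-- **(P9⁺) for `E[𝔮^∞]`-families** (JSW17 Prop. 3.3.2 / X11b `levelLiftingP_of_finite` without the two «no invariants» hypotheses): see the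
module docstring. [cite: JetchevSkinnerWan2017, Prop. 3.3.2 and Lemma 3.3.3 (arXiv:1512.06894 pp. 11–12)]
[cite: Howard2004HeegnerKolyvagin, Thm. 2.1.11 (arXiv:1202.6340 p. 6)] [cite: Castella2018, Thm. 2.3 (arXiv:1704.06608 p. 5)] -/
theorem levelLiftingP_of_proj (T : Finset (Place K)) (hPT : poitouTate_selmerStructure_duality K)
    (hK : ∀ w : InfinitePlace K, w.IsComplex)
    (e : W.geomPrimaryTorsion p →+ ↥(W.endEigenPrimaryTorsion p π r))
    (e' : W.geomPrimaryTorsion p →+ ↥(W.endEigenPrimaryTorsion p π r'))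
    (he₁ : ∀ x : ↥(W.endEigenPrimaryTorsion p π r), e x = x)
    (he : ∀ (σ : absoluteGaloisGroup K) (x : W.geomPrimaryTorsion p), e (σ • x) = σ • e x)
    (he'₁ : ∀ x : ↥(W.endEigenPrimaryTorsion p π r'), e' x = x)
    (he' : ∀ (σ : absoluteGaloisGroup K) (x : W.geomPrimaryTorsion p), e' (σ • x) = σ • e' x)
    (hsum : ∀ x, (e x : W.geomPrimaryTorsion p) + (e' x : W.geomPrimaryTorsion p) = x)
    (hcyc : ∀ (N : ℕ) (eN : (W.torsionGaloisModule ((p ^ N : ℕ) : ℤ)).toContRepresentation →ⁱL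
        (W.torsionGaloisModule ((p ^ N : ℕ) : ℤ)).toContRepresentation),
      (∀ x, primaryInclusion W p N (eN x) ∈ W.endEigenPrimaryTorsion p π r) →
        ∃ g : W.geomTorsion ((p ^ N : ℕ) : ℤ), ∀ x, ∃ a : ℤ, eN x = a • g)
    (j j' : (primaryGaloisModule W p).toContRepresentation →ⁱL (primaryGaloisModule W p).toContRepresentation)
    (hj : ∀ x, j x = (e x : W.geomPrimaryTorsion p)) (hj' : ∀ x, j' x = (e' x : W.geomPrimaryTorsion p))
    {𝔮 : HeightOneSpectrum (𝓞 K)} (h𝔭 : ((p : ℕ) : 𝓞 K) ∈ 𝔭.asIdeal)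
    (h𝔮 : ((p : ℕ) : 𝓞 K) ∈ 𝔮.asIdeal) (hne : 𝔮 ≠ 𝔭)
    (hSp : ∀ v ∈ S, ((p : ℕ) : 𝓞 K) ∉ v.asIdeal)
    (hinf : ∀ w : InfinitePlace K, (Sum.inl w : Place K) ∈ T)
    (hp : ∀ v : HeightOneSpectrum (𝓞 K), ((p : ℕ) : 𝓞 K) ∈ v.asIdeal → (Sum.inr v : Place K) ∈ T)
    (hSig : ∀ v ∈ S, (Sum.inr v : Place K) ∈ T)
    (hbad : ∀ v : HeightOneSpectrum (𝓞 K), ¬ W.HasGoodReductionAt v → (Sum.inr v : Place K) ∈ T)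
    (hfin' : Finite (((acStructure (primaryGaloisModule W p) p 𝔮
      {v | (Sum.inr v : Place K) ∈ T ∧ ((p : ℕ) : 𝓞 K) ∉ v.asIdeal}).selmerGroup).map (galoisCohomology.map j' 1)))
    (hfix : ∃ m : ℕ, ∀ Q : W.geomPrimaryTorsion p,
      (∀ σ : absoluteGaloisGroup (𝔮.adicCompletion K),
        GaloisRep.restrictField (𝔮.adicCompletion K) (primaryGaloisModule W p) σ Q = Q) → p ^ m • Q = 0)
    (K₀ : ℕ) (τ : ∀ v : (insert 𝔭 S : Set (HeightOneSpectrum (𝓞 K))),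
      galoisCohomology
        ((primaryGaloisModule W p).toLocal (Sum.inr (v : HeightOneSpectrum (𝓞 K)))) 1)
    (hτ : ∀ v, p ^ K₀ • τ v = 0)
    (hτj : ∀ v : (insert 𝔭 S : Set (HeightOneSpectrum (𝓞 K))),
      galoisCohomology.map (j.restrictField (Place.Completion (Sum.inr (v : HeightOneSpectrum (𝓞 K)) : Place K))) 1 (τ v) = τ v) :
    ∃ (N : ℕ) (x : galoisCohomology (W.torsionGaloisModule ((p ^ N : ℕ) : ℤ)) 1),
      x ∈ (upperStructureP W p N 𝔭 S).selmerGroup ∧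
        ∀ v : (insert 𝔭 S : Set (HeightOneSpectrum (𝓞 K))),
          galoisCohomology.localization (primaryGaloisModule W p)
            (Sum.inr (v : HeightOneSpectrum (𝓞 K))) 1
            (galoisCohomology.map (primaryInclusion W p N) 1 x) = τ v := by
  haveI : CompactSpace (absoluteGaloisGroup K) := absoluteGaloisGroup_compactSpace K
  have hdiv : W.zsmul_geomPoints_surjective := W.zsmul_geomPoints_surjective_holds
  have hSig' : ∀ v ∈ insert 𝔭 S, (Sum.inr v : Place K) ∈ T := by
    intro v hv
    rcases Set.mem_insert_iff.1 hv with rfl | hv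
    · exact hp v h𝔭
    · exact hSig v hv
  -- the exponent `e ≥ 1` of the `E[𝔮̄^∞]`-part of the relaxed conjugate group
  haveI := hfin'
  obtain ⟨ee, he1, hee⟩ := exists_pow_nsmul_eq_zero_of_finite
    (((acStructure (primaryGaloisModule W p) p 𝔮
      {v | (Sum.inr v : Place K) ∈ T ∧ ((p : ℕ) : 𝓞 K) ∉ v.asIdeal}).selmerGroup).map (galoisCohomology.map j' 1))
  have hee' : ∀ x ∈ (acStructure (primaryGaloisModule W p) p 𝔮
      {v | (Sum.inr v : Place K) ∈ T ∧ ((p : ℕ) : 𝓞 K) ∉ v.asIdeal}).selmerGroup, p ^ ee • galoisCohomology.map j' 1 x = 0 :=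
    fun x hx ↦ hee _ (AddSubgroup.mem_map_of_mem _ hx)
  -- enlarge `K₀` to `K₁ = K₀ + m` so that `p^{K₁}` also kills the local torsion at `𝔮`
  obtain ⟨m, hm⟩ := hfix
  set K₁ := K₀ + m with hK₁
  have hτ₁ : ∀ v, p ^ K₁ • τ v = 0 := fun v ↦ by
    rw [hK₁, pow_add, mul_comm, mul_smul, hτ, smul_zero]
  have hK₁fix : ∀ Q : W.geomPrimaryTorsion p,
      (∀ σ : absoluteGaloisGroup (𝔮.adicCompletion K),
        GaloisRep.restrictField (𝔮.adicCompletion K) (primaryGaloisModule W p) σ Q = Q) → p ^ K₁ • Q = 0 := fun Q hQ ↦ by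
    rw [hK₁, pow_add, mul_smul, hm Q hQ, smul_zero]
  -- levels and their projectors
  haveI : NeZero (p ^ (K₁ + ee)) := Levels.neZero_pow p (K₁ + ee)
  haveI : Finite (W.geomTorsion ((p ^ (K₁ + ee) : ℕ) : ℤ)) := finite_geomTorsion_pow W p (K₁ + ee)
  obtain ⟨eK, heK0, heKι, -, -, -, heKidem⟩ := exists_levelProj W p π r K₁ e he₁ he
  obtain ⟨eN, heN0, heNι, -, -, heNmem, -⟩ := exists_levelProj W p π r (K₁ + ee) e he₁ he
  obtain ⟨eN', heN'0, heN'ι, -, -, -, -⟩ := exists_levelProj W p π r' (K₁ + ee) e' he'₁ he'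
  have hsumN : ∀ x, eN x + eN' x = x := fun x ↦ by
    apply Subtype.ext
    rw [AddMemClass.coe_add, heN0, heN'0, ← AddMemClass.coe_add, hsum]
    rfl
  have hc1 : ∀ x, levelIncl W p K₁ ee (eK x) = eN (levelIncl W p K₁ ee x) := fun x ↦ by
    apply Subtype.ext
    rw [coe_levelIncl_apply, heK0, heN0]
    rfl
  have hc3 : ∀ x, primaryInclusion W p (K₁ + ee) (eN' x) = j' (primaryInclusion W p (K₁ + ee) x) := fun x ↦ by
    rw [heN'ι, hj']
  have hcK : ∀ x, primaryInclusion W p K₁ (eK x) = j (primaryInclusion W p K₁ x) := fun x ↦ by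
    rw [heKι, hj]
  obtain ⟨g, hg⟩ := hcyc (K₁ + ee) eN heNmem
  -- the Poitou–Tate family at level `p^N`, `N = K₁ + e`
  obtain ⟨inv, hperf, -, hur, hcompl⟩ := hPT (p ^ (K₁ + ee))
  -- local lifts `s_v = H¹(ẽ_{K₁}) s₀_v ∈ H¹(K_v, E[p^{K₁}])` of the `τ_v`
  have hs₀ : ∀ v : (insert 𝔭 S : Set (HeightOneSpectrum (𝓞 K))),
      ∃ sv : galoisCohomology (GaloisRep.restrictField
      (Place.Completion (Sum.inr (v : HeightOneSpectrum (𝓞 K)) : Place K))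
      (W.torsionGaloisModule ((p ^ K₁ : ℕ) : ℤ))) 1,
      galoisCohomology.map ((primaryInclusion W p K₁).restrictField
        (Place.Completion (Sum.inr (v : HeightOneSpectrum (𝓞 K)) : Place K))) 1 sv = τ v := fun v ↦
    (mem_range_map_primaryInclusion_restrictField_iff W p K₁ _ hdiv (τ v)).mpr (hτ₁ v)
  choose s₀ hs₀ using hs₀
  obtain ⟨s, hsdef⟩ : ∃ s : ∀ v : (insert 𝔭 S : Set (HeightOneSpectrum (𝓞 K))), galoisCohomology (GaloisRep.restrictField
      (Place.Completion (Sum.inr (v : HeightOneSpectrum (𝓞 K)) : Place K))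
      (W.torsionGaloisModule ((p ^ K₁ : ℕ) : ℤ))) 1,
      ∀ v, s v = galoisCohomology.map (eK.restrictField (Place.Completion (Sum.inr (v : HeightOneSpectrum (𝓞 K)) : Place K))) 1 (s₀ v) :=
    ⟨_, fun _ ↦ rfl⟩
  have hs : ∀ v : (insert 𝔭 S : Set (HeightOneSpectrum (𝓞 K))),
      galoisCohomology.map (eK.restrictField (Place.Completion (Sum.inr (v : HeightOneSpectrum (𝓞 K)) : Place K))) 1 (s v) = s v := by
    intro v
    obtain ⟨φ, hφ⟩ := oneCocycleClass_surjective _ (s₀ v)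
    rw [hsdef, ← hφ, galoisCohomology.map_one_oneCocycleClass, galoisCohomology.map_one_oneCocycleClass]
    congr 1
    refine Subtype.ext (ContinuousMap.ext fun σ ↦ ?_)
    exact heKidem (φ.1 σ)
  have hsτ : ∀ v : (insert 𝔭 S : Set (HeightOneSpectrum (𝓞 K))), galoisCohomology.map ((primaryInclusion W p K₁).restrictField
      (Place.Completion (Sum.inr (v : HeightOneSpectrum (𝓞 K)) : Place K))) 1 (s v) = τ v := by
    intro v
    obtain ⟨φ, hφ⟩ := oneCocycleClass_surjective _ (s₀ v)
    have h1 : galoisCohomology.map ((primaryInclusion W p K₁).restrictField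
        (Place.Completion (Sum.inr (v : HeightOneSpectrum (𝓞 K)) : Place K))) 1 (s v) =
        galoisCohomology.map (j.restrictField (Place.Completion (Sum.inr (v : HeightOneSpectrum (𝓞 K)) : Place K))) 1
          (galoisCohomology.map ((primaryInclusion W p K₁).restrictField
            (Place.Completion (Sum.inr (v : HeightOneSpectrum (𝓞 K)) : Place K))) 1 (s₀ v)) := by
      rw [hsdef, ← hφ, galoisCohomology.map_one_oneCocycleClass, galoisCohomology.map_one_oneCocycleClass,
        galoisCohomology.map_one_oneCocycleClass, galoisCohomology.map_one_oneCocycleClass]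
      congr 1
      refine Subtype.ext (ContinuousMap.ext fun σ ↦ ?_)
      exact hcK (φ.1 σ)
    rw [h1, hs₀, hτj]
  -- the Poitou–Tate data
  have hMn : ∀ x : W.geomTorsion ((p ^ (K₁ + ee) : ℕ) : ℤ), (p ^ (K₁ + ee)) • x = 0 := fun x ↦
    AddSubgroup.torsionBy.nsmul x
  have hTout : ∀ v : HeightOneSpectrum (𝓞 K), (Sum.inr v : Place K) ∉ T →
      ((p ^ (K₁ + ee) : ℕ) : 𝓞 K) ∉ v.asIdeal ∧
        GaloisRep.IsUnramifiedAt v (W.torsionGaloisModule ((p ^ (K₁ + ee) : ℕ) : ℤ)) := by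
    intro v hv
    have hpv : ((p : ℕ) : 𝓞 K) ∉ v.asIdeal := fun h ↦ hv (hp v h)
    have hgood : W.HasGoodReductionAt v := by
      by_contra hbad'
      exact hv (hbad v hbad')
    exact ⟨natCast_pow_not_mem p hpv _,
      isUnramifiedAt_torsionGaloisModule W hgood (intCast_pow_not_mem p hpv _)⟩
  have ht : ∀ v ∈ T, liftFamily W p K₁ ee s v ∈ upperStructureP W p (K₁ + ee) 𝔭 S v := by
    intro v _
    rcases v with w | v
    · rw [liftFamily_inl]; exact zero_mem _
    · by_cases hvI : v ∈ insert 𝔭 S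
      · by_cases hv𝔭 : v = 𝔭
        · subst hv𝔭
          rw [upperStructureP_self]; exact AddSubgroup.mem_top _
        · have hvS : v ∈ S := by
            rcases Set.mem_insert_iff.1 hvI with h | h
            · exact (hv𝔭 h).elim
            · exact h
          rw [upperStructureP_of_ne W p (K₁ + ee) 𝔭 S (fun h ↦ hv𝔭 (Sum.inr_injective h)),
            acLevelStructure_eq_top_of_mem_S W p (K₁ + ee) 𝔭 S hvS hv𝔭]
          exact AddSubgroup.mem_top _
      · rw [liftFamily_inr_of_not_mem W p K₁ ee s hvI]; exact zero_mem _
  -- Poitou–Tate: the lift exists (the obstruction vanishes by p670877)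
  obtain ⟨x, hx, hxt⟩ := (hcompl (W.torsionGaloisModule ((p ^ (K₁ + ee) : ℕ) : ℤ)) hMn T hTout
    (lowerStructure W p (K₁ + ee) 𝔭 (insert 𝔭 S) T) (upperStructureP W p (K₁ + ee) 𝔭 S)
    (lowerStructure_insert_le_upperStructureP W p (K₁ + ee) 𝔭 S T)
    (lowerStructure_isUnramifiedOutside W p (K₁ + ee) 𝔭 (insert 𝔭 S) T hinf hp hSig' hbad)
    (upperStructureP_isUnramifiedOutside W p (K₁ + ee) 𝔭 S T h𝔭 hinf hp hSig hbad)).1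
    (liftFamily W p K₁ ee s) ht fun y hy ↦
      sum_localTatePairingZMod_liftFamily_eq_zero_of_proj W p 𝔭 T K₁ ee hK h𝔮 hne hSig' hbad he1 eK eN eN' hsumN hc1
        ⟨g, hg⟩ j' hc3 hee' hK₁fix hperf hur s hs hy
  refine ⟨K₁ + ee, x, hx, fun v ↦ ?_⟩
  have hv := hxt (Sum.inr (v : HeightOneSpectrum (𝓞 K))) (hSig' v v.2)
  rw [localization_map_one]
  by_cases hv𝔭 : (v : HeightOneSpectrum (𝓞 K)) = 𝔭
  · -- at `𝔭`: the lower structure is the kernel of `H¹(ι_N)|_{K_𝔭}`, invisible after `H¹(ι_N)`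
    have hker : lowerStructure W p (K₁ + ee) 𝔭 (insert 𝔭 S) T (Sum.inr (v : HeightOneSpectrum (𝓞 K))) =
        (galoisCohomology.map ((primaryInclusion W p (K₁ + ee)).restrictField
          (Place.Completion (Sum.inr (v : HeightOneSpectrum (𝓞 K)) : Place K))) 1).ker := by
      rw [lowerStructure_inr_of_not W p (K₁ + ee) 𝔭 (insert 𝔭 S) T (fun h ↦ h.2 (by rw [hv𝔭]; exact h𝔭)), hv𝔭]
      exact acLevelStructure_eq_ker_of W p (K₁ + ee) 𝔭 (insert 𝔭 S) (acStructure_self _ p 𝔭 _)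
    rw [hker] at hv
    have hv' : galoisCohomology.map ((primaryInclusion W p (K₁ + ee)).restrictField
        (Place.Completion (Sum.inr (v : HeightOneSpectrum (𝓞 K)) : Place K))) 1
        (galoisCohomology.localization (W.torsionGaloisModule ((p ^ (K₁ + ee) : ℕ) : ℤ)) (Sum.inr (v : HeightOneSpectrum (𝓞 K))) 1 x -
          liftFamily W p K₁ ee s (Sum.inr (v : HeightOneSpectrum (𝓞 K)))) = 0 := hv
    have hv'' := sub_eq_zero.mp (((galoisCohomology.map ((primaryInclusion W p (K₁ + ee)).restrictField
        (Place.Completion (Sum.inr (v : HeightOneSpectrum (𝓞 K)) : Place K))) 1).map_sub _ _).symm.trans hv')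
    rw [hv'', liftFamily_inr_of_mem W p K₁ ee s v.2, map_primaryInclusion_map_levelIncl_restrictField]
    exact hsτ v
  · have hvS : (v : HeightOneSpectrum (𝓞 K)) ∈ S := by
      rcases Set.mem_insert_iff.1 v.2 with h | h
      · exact (hv𝔭 h).elim
      · exact h
    rw [lowerStructure_inr_of_mem W p (K₁ + ee) 𝔭 (insert 𝔭 S) T (hSig' v v.2) (hSp _ hvS), AddSubgroup.mem_bot, sub_eq_zero,
      liftFamily_inr_of_mem W p K₁ ee s v.2] at hv
    rw [hv, map_primaryInclusion_map_levelIncl_restrictField]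
    exact hsτ v

end Lift

end Summit.BirchSwinnertonDyer.BirchSwinnertonDyer.Theorems.PrintCf2.LevelEigen

end
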